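import Literature.InformationTheory.QuantumCodes.QuantumExpanderNoisySyndromeWitness
import HarnessLib

/-!
# Small-set-flip with a NOISY syndrome (Fawzi–Grospellier–Leverrier, FOCS 2018), part 4: §3.4 Lemma 26, first half —
# the minimum-weight word with the residual's syndrome IS equivalent to the residual when `E ∪ D` has no large
# connected `α₀`-subset — PROOF (deterministic)

Index of sources: `[cite: FawziGrospellierLeverrier2018FT]` = Fawzi–Grospellier–Leverrier, FOCS 2018 / arXiv:1808.03821, §3.4 Lemma 26
(p0020 L41-44) and the first half of its proof (p0020 L45 – p0021 L5): "We define `E_ls` as one of the minimal weight errors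
whose syndrome is the same than the syndrome of the error `E ⊕ Ê` … Let `K` be a connected component of `U ∪ E_ls` … `K ∪ (D ∩ Γ_X(K))`
is an `α₀`-subset of `(E ∩ K) ∪ (D ∩ Γ_X(K))` … `|K| ≤ γ₀√n` … the weight of `E ⊕ Ê ⊕ E_ls` is smaller than the minimal distance thus
`E_ls ∩ K` is equivalent to `(E ⊕ Ê) ∩ K`. Since this is true for all `K` then `E_ls` is equivalent to `E ⊕ Ê`."; Lemma 19
(locality), Lemma 21, Prop. 22; `[cite: FawziGrospellierLeverrier2018]` = STOC 2018 / arXiv:1711.08351v2, Prop. 12 / proof of Thm. 1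
(the component decomposition of the support; tree: `SmallSetFlip.hasAlphaCluster_of_not_mem_rowSpace`).

Topic `Literature/InformationTheory/QuantumCodes` (venture QEC, row 04 `prover-qec-type-04` gen 8, line L-SSF-NOISY = PARTITION v2.48
D50.L8, node N12). GENERIC over a syndrome matrix `Hs`, a generator matrix `Hg`, the tree's threshold rule `κ|F|`, a column bound
`|σ_X(v)| ≤ w|v|` (`w ≥ 1`), a graph `G` on the qubits in which two qubits sharing a check or a generator are adjacent (the qubit part of
FGL18b's syndrome adjacency graph `𝒢`), and a DISTANCE INPUT `hdist` ("every zero-syndrome word of weight `≤ t₀` is harmless";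
for quantum expander codes: LTZ15 Cor. 5 / `mem_rowSpace_of_syndrome_eq_zero_of_proj`). The percolation HYPOTHESIS is stated in
the form the printed proof uses it: every `G`-connected `K` whose mixed set `K ∪ (D ∩ Γ_X(K))` is an `α₀`-subset of
`(E ∩ K) ∪ (D ∩ Γ_X(K))` (`α₀ = κ/(2(κ+w))`, written multiplied out) has `|K| ≤ t₀` — this is what "`MaxConn_{α₀}(E ∪ D) ≤ γ₀√n`"
(Lemma 27, percolation on `𝒢`) delivers; the probabilistic discharge is NOT in this file.

* `card_supp_inter_le_of_minWeight` — global minimality of `E_ls` gives `|E_ls ∩ K| ≤ |(E ⊕ Ê) ∩ K|` on every part `K` on which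
  `E_ls ⊕ E ⊕ Ê` has zero restricted syndrome ("`|E_ls ∩ K| ≤ |(E ⊕ Ê) ∩ K| ≤ |U ∩ K|`");
* ★ `add_runOutput_add_mem_rowSpace_of_minWeight` — **Lemma 26, first half** (generic): under the hypotheses above, for a complete
  valid run from `σ_X(E) ⊕ 𝟙_D` with output `Ê` and any minimum-weight word `E_ls` with `σ_X(E_ls) = σ_X(E ⊕ Ê)`:
  `E_ls ⊕ E ⊕ Ê ∈ rowsp(Hg)`;
* `fgl18b_lemma26_equiv` — the quantum expander code instance (`Hs = expanderHX H`, `Hg = expanderHZ H`, `w = max Δ`,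
  `G = checkGraph (H_X; H_Z)`, `t₀ = min(γ_A n_A, γ_B n_B)` by LTZ15 Cor. 5 in projection form, `δ < 1/6`), for the output of any
  tree small-set-flip decoder on the noisy syndrome.

Column word: PROVED (kernel); no definitions, no named facts.
-/

namespace Literature.InformationTheory.QuantumCodes

open Finset Matrix Literature.Probability.LatticeModels

namespace SmallSetFlip

variable {Q C R : Type*} [Fintype Q] [Fintype C] [Fintype R] [DecidableEq Q] [DecidableEq C]

omit [Fintype C] [Fintype R] [DecidableEq C] in
/-- A `0/1`-vector is the indicator of its support. [folklore] -/
private theorem flipVec_filter_ne_zero (x : Q → ZMod 2) : flipVec (univ.filter fun q => x q ≠ 0) = x := by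
  classical
  funext q
  have h01 : ∀ z : ZMod 2, z = 0 ∨ z = 1 := by decide
  rcases h01 (x q) with h | h <;> simp [flipVec, h]

omit [Fintype C] [Fintype R] [DecidableEq C] in
/-- Restriction of a `0/1`-vector to `K` is the indicator of `supp ∩ K`. [folklore] -/
private theorem indicator_eq_flipVec_inter (x : Q → ZMod 2) (K : Finset Q) :
    Set.indicator (K : Set Q) x = flipVec ((univ.filter fun q => x q ≠ 0) ∩ K) := by
  classical
  funext q
  have h01 : ∀ z : ZMod 2, z = 0 ∨ z = 1 := by decide
  by_cases hq : q ∈ K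
  · rw [Set.indicator_of_mem (by exact_mod_cast hq)]
    rcases h01 (x q) with h | h <;> simp [flipVec, h, hq]
  · rw [Set.indicator_of_notMem (by exact_mod_cast hq)]
    simp [flipVec, hq]

omit [Fintype C] [Fintype R] [DecidableEq C] in
/-- **Global minimality restricts**: if `E_ls` has minimum weight among the words with its syndrome, and `u` is a zero-syndrome
word supported in `K` on which `E_ls ⊕ u = x`, i.e. `u = (E_ls ⊕ x) ∩ K` — then `|E_ls ∩ K| ≤ |x ∩ K|`
("`|E_ls ∩ K| ≤ |(E ⊕ Ê) ∩ K|`"). [cite: FawziGrospellierLeverrier2018FT, proof of Lemma 26 (arXiv p0021 L2-3)] -/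
theorem card_supp_inter_le_of_minWeight {Hs : Matrix C Q (ZMod 2)} (eLs x : Q → ZMod 2) (K : Finset Q)
    (hmin : ∀ v : Q → ZMod 2, Hs *ᵥ v = Hs *ᵥ eLs → hammingNorm eLs ≤ hammingNorm v)
    (hzero : Hs *ᵥ Set.indicator (K : Set Q) (eLs + x) = 0) :
    ((univ.filter fun q => eLs q ≠ 0) ∩ K).card ≤ ((univ.filter fun q => x q ≠ 0) ∩ K).card := by
  classical
  set u := Set.indicator (K : Set Q) (eLs + x) with hu
  -- `E_ls ⊕ u` has the same syndrome, so it is not lighter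
  have hsyn : Hs *ᵥ (eLs + u) = Hs *ᵥ eLs := by rw [Matrix.mulVec_add, hzero, add_zero]
  have hle := hmin (eLs + u) hsyn
  -- pointwise: `E_ls ⊕ u` agrees with `x` on `K` and with `E_ls` off `K`
  have hpt : ∀ q, (eLs + u) q = if q ∈ K then x q else eLs q := by
    intro q
    by_cases hq : q ∈ K
    · rw [if_pos hq, Pi.add_apply, hu, Set.indicator_of_mem (by exact_mod_cast hq), Pi.add_apply]
      have h2 : ∀ a b : ZMod 2, a + (a + b) = b := by decide
      exact h2 _ _
    · rw [if_neg hq, Pi.add_apply, hu, Set.indicator_of_notMem (by exact_mod_cast hq), add_zero]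
  -- split both weights over `K` and its complement
  have hsplit : ∀ y : Q → ZMod 2, hammingNorm y
      = ((univ.filter fun q => y q ≠ 0) ∩ K).card + ((univ.filter fun q => y q ≠ 0) \ K).card := by
    intro y
    unfold hammingNorm
    rw [← Finset.card_inter_add_card_sdiff (univ.filter fun q => y q ≠ 0) K]
  have hK : (univ.filter fun q => (eLs + u) q ≠ 0) ∩ K = (univ.filter fun q => x q ≠ 0) ∩ K := by
    ext q
    simp only [Finset.mem_inter, Finset.mem_filter, Finset.mem_univ, true_and, hpt q]
    constructor
    · rintro ⟨h1, h2⟩; rw [if_pos h2] at h1; exact ⟨h1, h2⟩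
    · rintro ⟨h1, h2⟩; rw [if_pos h2]; exact ⟨h1, h2⟩
  have hKc : (univ.filter fun q => (eLs + u) q ≠ 0) \ K = (univ.filter fun q => eLs q ≠ 0) \ K := by
    ext q
    simp only [Finset.mem_sdiff, Finset.mem_filter, Finset.mem_univ, true_and, hpt q]
    constructor
    · rintro ⟨h1, h2⟩; rw [if_neg h2] at h1; exact ⟨h1, h2⟩
    · rintro ⟨h1, h2⟩; rw [if_neg h2]; exact ⟨h1, h2⟩
  rw [hsplit eLs, hsplit (eLs + u), hK, hKc] at hle
  omega

/-- ★ **FGL18b Lemma 26, first half (generic, deterministic).** Data: syndrome matrix `Hs`, generator matrix `Hg`, threshold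
`κ > 0`, column bound `|σ_X(v)| ≤ w|v|` with `w ≥ 1`, a graph `G` on the qubits containing the check- and generator-adjacency,
a distance input `hdist` (zero-syndrome words of weight `≤ t₀` are in `rowsp(Hg)`), a complete valid run from the NOISY
syndrome `σ_X(E) ⊕ 𝟙_D` with output `Ê`, and a minimum-weight word `E_ls` with `σ_X(E_ls) = σ_X(E ⊕ Ê)`. Hypothesis (what
"`MaxConn_{α₀}(E ∪ D)` small" gives): every `G`-connected `K` with
`κ(|K| + |D ∩ Γ_X(K)|) ≤ 2(κ + w)(|E ∩ K| + |D ∩ Γ_X(K)|)` has `|K| ≤ t₀`. Conclusion: `E_ls ⊕ E ⊕ Ê ∈ rowsp(Hg)`.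
Proof as printed: split `v = E_ls ⊕ E ⊕ Ê` (zero syndrome) over the connected components `K` of `U ∪ E_ls`
(`U = E ∪ ⋃Fᵢ`); by Lemma 20 each part has zero syndrome; `K ∩ U` is closed in `U`, so Prop. 22 (component form) and
`|E_ls ∩ K| ≤ |(E ⊕ Ê) ∩ K| ≤ |U ∩ K|` (minimality) make `K ∪ (D ∩ Γ_X(K))` an `α₀`-subset, whence `|K| ≤ t₀` and the part is
harmless by `hdist`. [cite: FawziGrospellierLeverrier2018FT, Lemma 26 and its proof, first half (arXiv p0020 L41 – p0021 L5)] -/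
theorem add_runOutput_add_mem_rowSpace_of_minWeight {G : SimpleGraph Q}
    {Hs : Matrix C Q (ZMod 2)} {Hg : Matrix R Q (ZMod 2)}
    (hGX : ∀ c q q', q ≠ q' → Hs c q ≠ 0 → Hs c q' ≠ 0 → G.Adj q q')
    (hGZ : ∀ g q q', q ≠ q' → Hg g q ≠ 0 → Hg g q' ≠ 0 → G.Adj q q')
    {κ w : ℝ} (hκ : 0 < κ) (hw1 : 1 ≤ w)
    (hw : ∀ v : Q → ZMod 2, (hammingNorm (Hs *ᵥ v) : ℝ) ≤ w * hammingNorm v)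
    {t₀ : ℝ}
    (hdist : ∀ v : Q → ZMod 2, Hs *ᵥ v = 0 → (hammingNorm v : ℝ) ≤ t₀ → v ∈ rowSpace Hg)
    {E : Finset Q} {D : Finset C} {l : List (Finset Q)}
    (hrun : IsSSFRun κ Hs Hg (Hs *ᵥ flipVec E + flipVec D) l)
    (eLs : Q → ZMod 2) (hsyn : Hs *ᵥ eLs = Hs *ᵥ (flipVec E + runOutput l))
    (hmin : ∀ v : Q → ZMod 2, Hs *ᵥ v = Hs *ᵥ eLs → hammingNorm eLs ≤ hammingNorm v)
    (hclus : ∀ K : Finset Q, IsGraphConnected G K →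
      κ * ((K.card : ℝ) + (D ∩ univ.filter fun c => ∃ q ∈ K, Hs c q ≠ 0).card)
        ≤ 2 * (κ + w) * (((E ∩ K).card : ℝ) + (D ∩ univ.filter fun c => ∃ q ∈ K, Hs c q ≠ 0).card) →
      (K.card : ℝ) ≤ t₀) :
    eLs + (flipVec E + runOutput l) ∈ rowSpace Hg := by
  classical
  -- the support `U = E ∪ ⋃ Fᵢ` of the run and `U' = U ∪ supp E_ls`
  set U : Finset Q := E ∪ l.toFinset.biUnion id with hUdef
  have hEU : E ⊆ U := Finset.subset_union_left
  have hl : ∀ F ∈ l, F ⊆ U := fun F hF q hq =>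
    Finset.mem_union_right _ (Finset.mem_biUnion.2 ⟨F, List.mem_toFinset.2 hF, hq⟩)
  have hU : ∀ q ∈ U, q ∈ E ∨ ∃ F ∈ l, q ∈ F := by
    intro q hq
    rcases Finset.mem_union.1 hq with h | h
    · exact Or.inl h
    · obtain ⟨F, hF, hqF⟩ := Finset.mem_biUnion.1 h
      exact Or.inr ⟨F, List.mem_toFinset.1 hF, hqF⟩
  set x : Q → ZMod 2 := flipVec E + runOutput l with hxdef
  have hxU : ∀ q, x q ≠ 0 → q ∈ U := by
    intro q hq
    by_contra hqU
    apply hq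
    have h1 : flipVec E q = 0 := by
      simp only [flipVec, ite_eq_right_iff, one_ne_zero, imp_false]
      exact fun hqE => hqU (hEU hqE)
    have h2 : runOutput l q = 0 := by
      by_contra h
      obtain ⟨F, hF, hqF⟩ := exists_mem_of_runOutput_ne_zero l h
      exact hqU (hl F hF hqF)
    rw [hxdef, Pi.add_apply, h1, h2, add_zero]
  set U' : Finset Q := U ∪ univ.filter fun q => eLs q ≠ 0 with hU'def
  have hUU' : U ⊆ U' := Finset.subset_union_left
  -- `v = E_ls ⊕ E ⊕ Ê` has zero syndrome and lives in `U'`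
  set v : Q → ZMod 2 := eLs + x with hvdef
  have hv0 : Hs *ᵥ v = 0 := by
    rw [hvdef, Matrix.mulVec_add, hsyn]
    funext c; simp only [Pi.add_apply, Pi.zero_apply]
    have h2 : ∀ a : ZMod 2, a + a = 0 := by decide
    exact h2 _
  have hvU' : ∀ q, v q ≠ 0 → q ∈ U' := by
    intro q hq
    rw [hU'def, Finset.mem_union, Finset.mem_filter]
    by_cases h1 : eLs q = 0
    · left
      apply hxU
      intro hx; apply hq
      rw [hvdef, Pi.add_apply, h1, hx, add_zero]
    · exact Or.inr ⟨Finset.mem_univ _, h1⟩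
  have hsuppv : (univ.filter fun q => v q ≠ 0) ⊆ U' := fun q hq => hvU' q (Finset.mem_filter.1 hq).2
  -- connected components of `U'` in `G`
  set r : Q → Q → Prop := fun a b => G.Adj a b ∧ a ∈ U' ∧ b ∈ U' with hrdef
  set comp : Q → Finset Q := fun q => U'.filter fun q' => Relation.ReflTransGen r q q' with hcompdef
  have mem_comp : ∀ {q q' : Q}, q' ∈ comp q ↔ q' ∈ U' ∧ Relation.ReflTransGen r q q' := by
    intro q q'; simp only [hcompdef, Finset.mem_filter]
  have comp_subset : ∀ q, comp q ⊆ U' := fun q q' hq' => (mem_comp.1 hq').1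
  have self_mem : ∀ {q}, q ∈ U' → q ∈ comp q := fun hq => mem_comp.2 ⟨hq, Relation.ReflTransGen.refl⟩
  have closed : ∀ {q a b : Q}, a ∈ comp q → b ∈ U' → G.Adj a b → b ∈ comp q := by
    intro q a b ha hb hab
    rw [mem_comp] at ha ⊢
    exact ⟨hb, ha.2.tail ⟨hab, ha.1, hb⟩⟩
  have rsymm : ∀ {a b : Q}, Relation.ReflTransGen r a b → Relation.ReflTransGen r b a := by
    intro a b hab
    haveI : Std.Symm r := ⟨fun x y hxy => ⟨hxy.1.symm, hxy.2.2, hxy.2.1⟩⟩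
    exact Std.Symm.symm _ _ hab
  have comp_eq : ∀ {q q' : Q}, q' ∈ comp q → comp q' = comp q := by
    intro q q' h
    rw [mem_comp] at h
    ext z
    rw [mem_comp, mem_comp]
    constructor
    · rintro ⟨hz, hqz⟩; exact ⟨hz, h.2.trans hqz⟩
    · rintro ⟨hz, hqz⟩; exact ⟨hz, (rsymm h.2).trans hqz⟩
  have conn : ∀ {q}, q ∈ U' → IsGraphConnected G (comp q) := by
    intro q hq
    rw [isGraphConnected_iff_reflTransGen (hv := self_mem hq)]
    intro z hz
    rw [mem_comp] at hz
    have key : ∀ z, Relation.ReflTransGen r q z →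
        Relation.ReflTransGen (fun a b => G.Adj a b ∧ a ∈ comp q ∧ b ∈ comp q) q z := by
      intro z hz
      induction hz with
      | refl => exact Relation.ReflTransGen.refl
      | @tail s t hs hst ih =>
        have hs' : s ∈ comp q := mem_comp.2 ⟨hst.2.1, hs⟩
        exact ih.tail ⟨hst.1, hs', closed hs' hst.2.2 hst.1⟩
    exact key z hz.2
  have closedX : ∀ q₀, ∀ q ∈ comp q₀, ∀ q' ∈ U', ∀ c, Hs c q ≠ 0 → Hs c q' ≠ 0 → q' ∈ comp q₀ := by
    intro q₀ q hq q' hq' c h1 h2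
    by_cases hqq : q = q'
    · exact hqq ▸ hq
    · exact closed hq hq' (hGX c q q' hqq h1 h2)
  have closedZ : ∀ q₀, ∀ q ∈ comp q₀, ∀ q' ∈ U', ∀ g, Hg g q ≠ 0 → Hg g q' ≠ 0 → q' ∈ comp q₀ := by
    intro q₀ q hq q' hq' g h1 h2
    by_cases hqq : q = q'
    · exact hqq ▸ hq
    · exact closed hq hq' (hGZ g q q' hqq h1 h2)
  -- `v` is the sum of its restrictions to the components
  have hdecomp : ∑ K ∈ U'.image comp, Set.indicator (K : Set Q) v = v := by
    ext q
    rw [Finset.sum_apply]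
    by_cases hq : q ∈ U'
    · rw [Finset.sum_eq_single (comp q)]
      · rw [Set.indicator_of_mem (by exact_mod_cast self_mem hq)]
      · intro K hK hne
        obtain ⟨q', -, rfl⟩ := Finset.mem_image.1 hK
        rw [Set.indicator_of_notMem]
        intro hqK
        have hqK' : q ∈ comp q' := by exact_mod_cast hqK
        exact hne (comp_eq hqK').symm
      · intro h
        exact absurd (Finset.mem_image.2 ⟨q, hq, rfl⟩) h
    · have hvq : v q = 0 := by by_contra h; exact hq (hvU' q h)
      rw [hvq]
      refine Finset.sum_eq_zero fun K hK => ?_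
      obtain ⟨q', -, rfl⟩ := Finset.mem_image.1 hK
      rw [Set.indicator_of_notMem]
      intro h
      exact hq (comp_subset q' (by exact_mod_cast h))
  -- each part is harmless
  rw [← hdecomp]
  refine Submodule.sum_mem _ fun K hK => ?_
  obtain ⟨q₀, hq₀, rfl⟩ := Finset.mem_image.1 hK
  set K := comp q₀ with hKdef
  have hKU' : K ⊆ U' := comp_subset q₀
  set CK : Finset C := univ.filter fun c => ∃ q ∈ K, Hs c q ≠ 0 with hCK
  -- (i) the part has zero syndrome (Lemma 20 with `W = supp v ⊆ U'`)
  have hloc := indicator_mulVec_flipVec_eq Hs U' K (univ.filter fun q => v q ≠ 0) (closedX q₀) hsuppv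
  rw [flipVec_filter_ne_zero, hv0, Set.indicator_zero', ← indicator_eq_flipVec_inter] at hloc
  have hpart0 : Hs *ᵥ Set.indicator (K : Set Q) v = 0 := hloc.symm
  -- (ii) the part is light: `|K| ≤ t₀`
  refine hdist _ hpart0 ?_
  have hKle : (hammingNorm (Set.indicator (K : Set Q) v) : ℝ) ≤ K.card := by
    rw [indicator_eq_flipVec_inter, QuantumExpander.hammingNorm_flipVec]
    exact_mod_cast Finset.card_le_card Finset.inter_subset_right
  refine hKle.trans (hclus K (conn hq₀) ?_)
  -- the `α₀`-subset inequality for `K`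
  -- (a) `K ∩ U` is closed in `U`; Prop. 22 (component form)
  have hKUX : ∀ q ∈ K ∩ U, ∀ q' ∈ U, ∀ c, Hs c q ≠ 0 → Hs c q' ≠ 0 → q' ∈ K ∩ U := by
    intro q hq q' hq' c h1 h2
    exact Finset.mem_inter.2 ⟨closedX q₀ q (Finset.mem_inter.1 hq).1 q' (hUU' hq') c h1 h2, hq'⟩
  have hKUZ : ∀ q ∈ K ∩ U, ∀ q' ∈ U, ∀ g, Hg g q ≠ 0 → Hg g q' ≠ 0 → q' ∈ K ∩ U := by
    intro q hq q' hq' g h1 h2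
    exact Finset.mem_inter.2 ⟨closedZ q₀ q (Finset.mem_inter.1 hq).1 q' (hUU' hq') g h1 h2, hq'⟩
  have h22 := card_closed_le_of_noisy_run hκ hw hrun hEU Finset.inter_subset_right hKUX hKUZ hl hU
  have hEK : E ∩ (K ∩ U) = E ∩ K := by
    ext q; simp only [Finset.mem_inter]
    constructor
    · rintro ⟨h1, h2, -⟩; exact ⟨h1, h2⟩
    · rintro ⟨h1, h2⟩; exact ⟨h1, h2, hEU h1⟩
  rw [hEK] at h22
  have hCKU : (D ∩ univ.filter fun c => ∃ q ∈ K ∩ U, Hs c q ≠ 0).card ≤ (D ∩ CK).card := by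
    refine Finset.card_le_card (Finset.inter_subset_inter_left ?_)
    intro c hc
    rw [Finset.mem_filter] at hc ⊢
    obtain ⟨q, hq, hcq⟩ := hc.2
    exact ⟨hc.1, q, (Finset.mem_inter.1 hq).1, hcq⟩
  have hCKU' : ((D ∩ univ.filter fun c => ∃ q ∈ K ∩ U, Hs c q ≠ 0).card : ℝ) ≤ (D ∩ CK).card := by
    exact_mod_cast hCKU
  -- (b) `|K| ≤ |K ∩ U| + |E_ls ∩ K|` and `|E_ls ∩ K| ≤ |x ∩ K| ≤ |K ∩ U|` (minimality)
  have hminK := card_supp_inter_le_of_minWeight (Hs := Hs) eLs x K hmin (by rw [← hvdef]; exact hpart0)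
  have hxK : ((univ.filter fun q => x q ≠ 0) ∩ K).card ≤ (K ∩ U).card := by
    refine Finset.card_le_card ?_
    intro q hq
    rw [Finset.mem_inter, Finset.mem_filter] at hq
    exact Finset.mem_inter.2 ⟨hq.2, hxU q hq.1.2⟩
  have hKsplit : K.card ≤ (K ∩ U).card + ((univ.filter fun q => eLs q ≠ 0) ∩ K).card := by
    have hcov : K ⊆ (K ∩ U) ∪ ((univ.filter fun q => eLs q ≠ 0) ∩ K) := by
      intro q hq
      have hq' := hKU' hq
      rw [hU'def, Finset.mem_union] at hq'
      rw [Finset.mem_union, Finset.mem_inter, Finset.mem_inter]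
      rcases hq' with h | h
      · exact Or.inl ⟨hq, h⟩
      · exact Or.inr ⟨h, hq⟩
    exact (Finset.card_le_card hcov).trans (Finset.card_union_le _ _)
  have hK2 : (K.card : ℝ) ≤ 2 * (K ∩ U).card := by
    have : K.card ≤ 2 * (K ∩ U).card := by omega
    exact_mod_cast this
  -- (c) assemble
  have hDK0 : (0 : ℝ) ≤ (D ∩ CK).card := Nat.cast_nonneg _
  have hEK0 : (0 : ℝ) ≤ (E ∩ K).card := Nat.cast_nonneg _
  nlinarith [h22, hK2, hCKU', hκ, hw1, hDK0, hEK0]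

end SmallSetFlip

/-! ### The quantum expander code instance -/

namespace QuantumExpander

variable {A B : Type*} [Fintype A] [Fintype B] [DecidableEq A] [DecidableEq B]

/-- **FGL18b Lemma 26, first half, for quantum expander codes and the tree's small-set-flip decoders.** Let `G` be
`(Δ_A, Δ_B)`-biregular (`Δ ≥ 1`), `(γ_A, δ_A, γ_B, δ_B)`-expanding with `0 ≤ δ_A, δ_B < 1/6`, `Dec` a small-set-flip decoder
of the tree (threshold `κ > 0`) run on the noisy syndrome `σ_X(E) ⊕ 𝟙_D` with output `Ê`, and `E_ls` a minimum-weight word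
with `σ_X(E_ls) = σ_X(E ⊕ Ê)`. If every `K` connected in the adjacency graph `𝒢 = checkGraph (H_X; H_Z)` with
`κ(|K| + |D ∩ Γ_X(K)|) ≤ 2(κ + max Δ)(|E ∩ K| + |D ∩ Γ_X(K)|)` has `|K| ≤ min(γ_A n_A, γ_B n_B)` (the event
"`MaxConn_{α₀}(E ∪ D) ≤ γ₀√n`" as used), then `E_ls ≡ E ⊕ Ê` modulo `C_Z^⊥` (distance input: LTZ15 Cor. 5 in projection form,
`mem_rowSpace_of_syndrome_eq_zero_of_proj`). [cite: FawziGrospellierLeverrier2018FT, Lemma 26, first half (arXiv p0020 L41 – p0021 L5)] -/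
theorem fgl18b_lemma26_equiv (H : Matrix B A (ZMod 2)) {dA dB : ℕ} {γA δA γB δB : ℝ}
    (hreg : IsBiregular H dA dB) (hexp : IsLeftRightExpanding H dA dB γA δA γB δB)
    (hdA : 0 < dA) (hdB : 0 < dB) (hδA : 0 ≤ δA) (hδA' : δA < 1 / 6) (hδB : 0 ≤ δB) (hδB' : δB < 1 / 6)
    {κ : ℝ} (hκ0 : 0 < κ)
    (Dec : Decoder (A × B → ZMod 2) ((A × A) ⊕ (B × B) → ZMod 2))
    (hDec : IsSSFDecoder κ (expanderHX H) (expanderHZ H) Dec)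
    (E : Finset ((A × A) ⊕ (B × B))) (D : Finset (A × B))
    (eLs : (A × A) ⊕ (B × B) → ZMod 2)
    (hsyn : expanderHX H *ᵥ eLs = expanderHX H *ᵥ (flipVec E + Dec (expanderHX H *ᵥ flipVec E + flipVec D)))
    (hmin : ∀ v : (A × A) ⊕ (B × B) → ZMod 2, expanderHX H *ᵥ v = expanderHX H *ᵥ eLs →
      hammingNorm eLs ≤ hammingNorm v)
    (hclus : ∀ K : Finset ((A × A) ⊕ (B × B)),
      IsGraphConnected (checkGraph (Matrix.fromRows (expanderHX H) (expanderHZ H))) K →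
      κ * ((K.card : ℝ) + (D ∩ univ.filter fun c => ∃ q ∈ K, expanderHX H c q ≠ 0).card)
        ≤ 2 * (κ + ((max dA dB : ℕ) : ℝ))
          * (((E ∩ K).card : ℝ) + (D ∩ univ.filter fun c => ∃ q ∈ K, expanderHX H c q ≠ 0).card) →
      (K.card : ℝ) ≤ min (γA * Fintype.card A) (γB * Fintype.card B)) :
    eLs + (flipVec E + Dec (expanderHX H *ᵥ flipVec E + flipVec D)) ∈ rowSpace (expanderHZ H) := by
  classical
  obtain ⟨l, hrun, hl⟩ := hDec (expanderHX H *ᵥ flipVec E + flipVec D)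
  rw [hl] at hsyn ⊢
  set G := checkGraph (Matrix.fromRows (expanderHX H) (expanderHZ H)) with hGdef
  have hGX : ∀ c q q', q ≠ q' → expanderHX H c q ≠ 0 → expanderHX H c q' ≠ 0 → G.Adj q q' :=
    fun c q q' hne h1 h2 => checkGraph_fromRows_adj_of_X H c q q' hne h1 h2
  have hGZ : ∀ g q q', q ≠ q' → expanderHZ H g q ≠ 0 → expanderHZ H g q' ≠ 0 → G.Adj q q' :=
    fun g q q' hne h1 h2 => checkGraph_fromRows_adj_of_Z H g q q' hne h1 h2
  have hdM1 : (1 : ℝ) ≤ ((max dA dB : ℕ) : ℝ) := by exact_mod_cast le_trans hdA (le_max_left _ _)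
  have hw : ∀ v : (A × A) ⊕ (B × B) → ZMod 2,
      (hammingNorm (expanderHX H *ᵥ v) : ℝ) ≤ ((max dA dB : ℕ) : ℝ) * hammingNorm v := fun v => by
    exact_mod_cast hammingNorm_expanderHX_mulVec_le_max H hreg v
  have hdist : ∀ v : (A × A) ⊕ (B × B) → ZMod 2, expanderHX H *ᵥ v = 0 →
      (hammingNorm v : ℝ) ≤ min (γA * Fintype.card A) (γB * Fintype.card B) → v ∈ rowSpace (expanderHZ H) := by
    intro v hv hle
    have hsupp : ((supp v).card : ℝ) = hammingNorm v := by simp [supp, hammingNorm]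
    refine mem_rowSpace_of_syndrome_eq_zero_of_proj H hreg hexp hdA hdB hδA hδA' hδB hδB' hv ?_ ?_
    · have h1 : ((projA (supp v)).card : ℝ) ≤ (supp v).card := by exact_mod_cast card_projA_le (supp v)
      linarith [min_le_left (γA * Fintype.card A) (γB * Fintype.card B)]
    · have h1 : ((projB (supp v)).card : ℝ) ≤ (supp v).card := by exact_mod_cast card_projB_le (supp v)
      linarith [min_le_right (γA * Fintype.card A) (γB * Fintype.card B)]
  exact SmallSetFlip.add_runOutput_add_mem_rowSpace_of_minWeight hGX hGZ hκ0 hdM1 hw hdist hrun eLs hsyn hmin hclus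

end QuantumExpander

end Literature.InformationTheory.QuantumCodes
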